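import Summits.CriticalPhenomena.SAWScalingLimit.Theorems.SAWLeftRightFKGFKGToTraversalBoundOutlineTour
import HarnessLib

/-!
# Wall-follower tour of a finite lattice site set: the minimal injective period

Crux `SAWLeftRightFKG.FKGToTraversalBound` (stmt-CriticalPhenomena-1878), line `slit-necklace`, lead
prover-line-stmt-CriticalPhenomena-1878-c5-0; witness unit U1-d (wall-follower tour), on top of
`…OutlineTour` (`btour_periodic`, `bnext_injective_of_isBEdge`, `exists_minimal_period`).

* `btour_minimalPeriod` (registered) — for a finite site set `A : Finset (Site 2)` and a boundary edge `e₀`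
  of `↑A`, the wall-follower tour of `e₀` has a positive period `N` within which it has no repeats
  (the `Finset` / pointwise-injectivity packaging of `exists_minimal_period`);
* `btour_minimalPeriod_surj` (rider) — the same period moreover exhausts the orbit: every tour edge is one
  of the first `N`.

All statements folklore ("wall follower" / boundary tracing of a polyomino); no literature fact; nothing
restates the crux.
-/

noncomputable section

open Literature.Probability.LatticeModels

namespace Summit.CriticalPhenomena.SAWScalingLimit.Theorems.FKGToTraversalBound.SlitNecklace

/-- **Registered stub: the minimal injective period of the wall-follower tour.**  For a finite site set `A`
and a boundary edge `e₀` of `A`, there is `N > 0` with `btour A e₀ N = e₀` such that the first `N` tour edges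
`btour A e₀ 0, …, btour A e₀ (N - 1)` are pairwise distinct.  (Take the least positive return time of
`btour_periodic`; a repeat `btour j = btour j'` with `j < j' < N` would, after cancelling `j` steps by
`bnext_injective_of_isBEdge`, give a return at `0 < j' - j < N`.) [folklore] -/
theorem btour_minimalPeriod : ∀ (A : Finset (Site 2)) (e₀ : Site 2 × ODir), IsBEdge (↑A : Set (Site 2)) e₀ → ∃ N : ℕ, 0 < N ∧ btour (↑A : Set (Site 2)) e₀ N = e₀ ∧ ∀ j j', j < N → j' < N → btour (↑A : Set (Site 2)) e₀ j = btour (↑A : Set (Site 2)) e₀ j' → j = j' := by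
  intro A e₀ h₀
  obtain ⟨N, hpos, hper, hinj, -⟩ := exists_minimal_period (↑A : Set (Site 2)) A.finite_toSet h₀
  exact ⟨N, hpos, hper, fun j j' hj hj' h => hinj (Set.mem_Iio.2 hj) (Set.mem_Iio.2 hj') h⟩

/-- **Rider: the minimal injective period exhausts the orbit.**  Same as `btour_minimalPeriod`, recording in
addition that every tour edge `btour A e₀ n` already occurs among the first `N` (namely at `n % N`).
[folklore] -/
theorem btour_minimalPeriod_surj (A : Finset (Site 2)) {e₀ : Site 2 × ODir}
    (h₀ : IsBEdge (↑A : Set (Site 2)) e₀) :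
    ∃ N : ℕ, 0 < N ∧ btour (↑A : Set (Site 2)) e₀ N = e₀ ∧
      (∀ j j', j < N → j' < N → btour (↑A : Set (Site 2)) e₀ j = btour (↑A : Set (Site 2)) e₀ j' → j = j') ∧
      ∀ n, ∃ m < N, btour (↑A : Set (Site 2)) e₀ n = btour (↑A : Set (Site 2)) e₀ m := by
  obtain ⟨N, hpos, hper, hinj, hsurj⟩ := exists_minimal_period (↑A : Set (Site 2)) A.finite_toSet h₀
  exact ⟨N, hpos, hper, fun j j' hj hj' h => hinj (Set.mem_Iio.2 hj) (Set.mem_Iio.2 hj') h, hsurj⟩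

end Summit.CriticalPhenomena.SAWScalingLimit.Theorems.FKGToTraversalBound.SlitNecklace

end
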